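import Literature.MathematicalPhysics.QuantumFieldTheory.Balaban1983to89.B9Cor36GCubeLocDefectCover
import Literature.MathematicalPhysics.QuantumFieldTheory.Balaban1983to89.B9Cor36GCubeAtLocCfg
import Literature.MathematicalPhysics.QuantumFieldTheory.Balaban1983to89.B9Cor36DPDsCubeAtLocCfg

/-!
# `Balaban1983to89.B9Cor36GCubeLocDefectAtLocCfg` — THE COVER SUMS OF THE DEFECT LETTERS `Σ_□ conj b(E_□)`, `Σ_□ conj b(E♯_□)` OF THE BOND-SECTOR CUBE LETTERS AT THE
# LOCALISED FIELDS `Ṽ_□ = e^{iηχ̃_□A_□}`, UNIFORMLY IN THE MEMBER: `≺ Θ_E·e^{−δ_E·M_h}·e^{−δ_E·d(a,a′)}` with `Θ_E, δ_E` functions of `d, L, b₀, b₁, M₂` and of the P-word's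
# constants only — D3 fed with G-F7 v1.1 (`hG`), (2.61) and the scale transfers of the cube geometry, modulo the displayed P-word majorant `hP` at the datum
# (layer D2a, p38 g46 — landed the same hour, so the CLOSED form is here too) (sub-row G-B9-LETTERS, module M5.1b-G item 2, programme DEFECT-R, FILE D4; design (R) term,
# NOT in print)

statement-level skeleton of published theorems with citation tags; proofs where landed; nothing here is a claim about the Yang–Mills mass gap

THE PRINTED LOCUS (verbatim, held `paper:balaban1985-cmp99-background-propagators`, journal page = PDF page + 388).  (3.105) p. 414 («T = Σ_□ h_□ … |T| ≦ ½ … For M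
sufficiently large»); p. 411 l. 12–14; p. 412 l. 31–36 («exp(−δ₀M) … sufficiently small»); p. 399 (3.49) («For the operator P = I − R we obtain, using again Lemma 2.1,
[|P(x,x′)|, |(DP)(x,x′)|, |(PD*)(x,x′)|, |(DPD*)(x,x′)|] ≦ O(1)[1, (Lʲη)⁻¹, (Lʲ′η)⁻¹, (Lʲη)⁻¹(Lʲ′η)⁻¹]…»); Cor. 3.6 p. 408 l. 3–14; p. 409 l. 1–5; Thm 3.3 (3.42) p. 397;
[4] (2.79)–(2.85) pp. 237–238, (2.36) p. 229, Lemma 2.1 (2.61) p. 234, (2.51)–(2.55) p. 232.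

WHY THIS FILE.  D3 `B9Cor36GCubeLocDefectCover` (this seat) bounds the two cover sums GIVEN, at every cube, the engine data `hP □` (P-word), `hG □` (`GVK(Ṽ_□)`), (2.61)
and the scale transfers with constants uniform in □.  THIS FILE supplies everything except `hP` from the landed uniform theorems: `hG □` = G-F7 v1.1
`B9Cor36GCubeAtLocCfg.cor36_G_cube_at_locCfg'` (transferred flat entry `GVK(Ṽ_□) ≺ A_Gθ·ℓ_□²·e^{−(1−9∕5000)ρd_□}` under the (3.35) cube datum), (2.61) = p33
`exists_h261_geoCK`, scale transfers = p33 `hST_geoCK` (`Λ = L⁴`), one master rate `δ⋆ = min((1 − 9∕5000)ρ, δ_P)` (rate monotonicity), exponents `α_st = 1∕10`,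
`a_sep = 2∕5`, `ρ = 1∕2` (`1∕10 + 2∕5 + 1∕2 = 1`); the P-word majorant is DISPLAYED at the datum level in the shape layer D2a announced (p38 g46, 21:42Z:
`∃ δ_P K_P M_P T_P N_P a_P, ∀ i □ Rr H (thresholds) ∀ A Q C ξ Λ (datum), conj b(DP_□D*(Ṽ_□)) ≺ K_P·ℓ_□(a)⁻²·e^{−δ_P d_□}`), here with G-F7's eleven datum binders
(a superset of D2a's readings), so that the closing plug is two lines when D2a lands.

WHAT THIS FILE CERTIFIES (kernel-checked; 0 `def`, 0 `def … : Prop`, 0 sorry; standard axioms only)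

★★★ `sum_conj_locDefect_at_locCfg` — GIVEN `hP` (displayed as above): there are `δ_E > 0`, `Θ_E ≥ 0`, member thresholds `M₀, T₀, N₀` and `a₁ > 0` such that for every member
above threshold, every family over the cover cubes □ of bi-contractive gauges `u_□`, vector potentials `A_□` of Hermitian type with (3.35) cube data `(Q_□, C_□, ξ_□, Λ_□)`
(`sRead C_□ Λ_□ ≤ a₁`), every section `ιB` and every `Rr′, Hp`:
`Σ_□ conj b(E_□(u_□, χ_□, h_□; Ṽ_□)) ≺ Θ_E·e^{−δ_E·M_h}·e^{−δ_E·d(a,a′)}` AND `Σ_□ conj b(E♯_□(…)) ≺ Θ_E·e^{−δ_E·M_h}·e^{−δ_E·d(a,a′)}` over `(toB6 (geo9K i) Rr′ Hp, ιB∘blkV1)` —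
the 4th families of M5.7's `hrest` ∕ `hV'` (the latter in flat form; D3's `hasMajorant_sum_conj_locDefectTBY_src` converts to `ℓ(a)ℓ(a′)⁻¹` by one member-side scale
transfer), with the «M sufficiently large» smallness `e^{−δ_E·M_h}` EXPLICIT for the assembler's `hsmall ∕ hsmallV`.
★★★ `sum_conj_locDefect_at_locCfg'` — THE SAME, CLOSED: `hP` supplied by p38 g46's D2a `B9Cor36DPDsCubeAtLocCfg.hasMajorant_conj_DPDsCubeY_at_locCfg` (p672560,
landed 2026-08-28T22:09Z); NO displayed operator input (two-line plug).
★ `scaleTransfer_len_geo9K` (the p. 398 transfer of the weight `Lʲη` on the member's geometry under `log L ≦ αδ(2L²−1)M`) and ★★★ `sum_conj_locDefectTBY_src_at_locCfg'` — the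
`E♯` sum CLOSED in `hV'`'s currency: `Σ_□ conj b(E♯_□) ≺ Θ_V·e^{−δ_V·M_h}·ℓ(a)·ℓ(a′)⁻¹·e^{−δ_V·d(a,a′)}` (`δ_V = δ_E∕2`, `Θ_V = Θ_E·L`, one more member threshold).

HONEST SCOPE ∕ NOT CLAIMED.  (i) (R)-design terms (as D1–D3).  (ii) DISPLAYED: in the first theorem `hP` (proved elsewhere: layer D2a, p38 g46's
`B9Cor36DPDsCubeAtLocCfg`, USED BY NAME in the second), the (3.35) datum per cube (which class cube supplies it is the assembler's, cell erratum N-c5-7), the bi-contractive gauges, `[NormOneClass 𝔸]`, `[Fintype (geo9K i).Site]`.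
(iii) NOT here: families 1–3 of `hrest` ∕ `hV'`, the knit into `eBlock_kernelFamilyBInv_GAY_of_localInverseCubes''` and its `hsmall` bookkeeping (assembler ∕ t2s-1
lineage), the assembler's choice of one rate for all families (`kernel_rate_mono`).  Count-neutral; NOT a node discharge; no summit ∕ sub-problem statement is
proved; nothing continuum ∕ OS ∕ mass-gap ∕ Clay; YM mass gap NOT proved (Track A conditional rung).  No `sorry`, no `axiom`, no `… : Prop` fact, no `instance`, no
`notation`, no `def`.  NEW file; nothing landed is modified.  Cell `lit-balaban`, seat `lit-balaban-p33` gen 102, 2026-08-28; `--supports stmt-QuantumFields-19200`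
as helper.  Net new unproved facts: 0.

RELATED IN THE TREE, NOT DUPLICATED (searched 2026-08-28: `rg 'sum_conj_locDefect'` = D3 only): D3 `B9Cor36GCubeLocDefectCover`, G-F7 `B9Cor36GCubeAtLocCfg`, p38 g46
D2a `B9Cor36DPDsCubeAtLocCfg`, p33 `B9CubeGeometryInputs` (`exists_h261_geoCK`, `hST_geoCK`), p33 `B9Cor35CinvAtCubeLetters.kernel_rate_mono` — all USED BY NAME.
-/

noncomputable section

namespace Literature.MathematicalPhysics.QuantumFieldTheory.Balaban1983to89.B9Cor36GCubeLocDefectAtLocCfg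

open NormedSpace Complex
open B6RandomWalk (HasMajorant hasMajorant_mono Ineq261 c1_nonneg)
open B9Thm34Ext (toB6)
open B9Ineq347 (ScaleTransfer)
open B9Eq352DivFormLetters (conj)
open B9Eq39Adjoint (covD)
open B6KLevelCensusIndexV1 (KIdx kGeo)
open B6Cover236MultiLevelBlocks (cubes)
open B6GlobalChartV1 (PV boxEquiv blkV1)
open B9BackgroundsKLevelV1 (shiftsV1)
open B6Ineq2142KLevelV1 (β)
open B9GeoNormsKLevelV1 (geo9K geo9K_dist_nonneg)
open B9Eq360DeltaPrimeAY (AfldY)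
open B9Thm37CubeCoverCommutators (hTY)
open B9Eq3105AtLetters (DPDsCubeY)
open B9CubeGeometryInputs (geoCK geoCK_dist_axioms RM1 N1 exists_h261_geoCK hST_geoCK)
open B9Cor35GCubeInputsAtOne (blkBK GVK)
open B9Cor35CinvAtCubeLetters (kernel_rate_mono)
open B9Cor36CubeCutoffs (SC NearC chiY locCfgY)
open B9Cor36GCubeWindows (sRead)
open B9Cor36GCubeLocLetter (locDefectBY locDefectTBY)
open B9Cor36GCubeAtLocCfg (cor36_G_cube_at_locCfg')
open B9Cor36DPDsCubeAtLocCfg (hasMajorant_conj_DPDsCubeY_at_locCfg)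
open B9Cor36GCubeLocDefectCover (hasMajorant_sum_conj_locDefectBY hasMajorant_sum_conj_locDefectTBY flat_le_src_weight)
open B9GeoLemma21KLevelV1 (transferL_geo9K)
open Node00 (SiteY BlkY IBondY FBondY CfgY GaugeY toKT parSymY parBY)

variable {d ℓ : ℕ} {hd : 1 ≤ d + 1} {hL : Odd (ℓ + 1) ∧ 1 < ℓ + 1} {b₀ b₁ : ℝ}
variable {𝔸 : Type} [NormedRing 𝔸] [NormedAlgebra ℂ 𝔸] [CompleteSpace 𝔸]
variable {ι : Type} [Fintype ι] (b : Module.Basis ι ℝ 𝔸)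

set_option maxHeartbeats 6400000 in
/-- ★★★ **THE COVER SUMS OF THE TWO DEFECT LETTERS AT THE LOCALISED FIELDS, UNIFORMLY IN THE MEMBER** (M5.1b-G item 2, modulo the displayed P-word majorant `hP` of
layer D2a): `Σ_□ conj b(E_□) ≺ Θ_E·e^{−δ_E·M_h}·e^{−δ_E·d(a,a′)}` and `Σ_□ conj b(E♯_□) ≺ Θ_E·e^{−δ_E·M_h}·e^{−δ_E·d(a,a′)}` over the member's bond carrier, for every
member above the thresholds and every family of (3.35) cube data — D3 with `hG` := G-F7 v1.1's transferred flat entry, (2.61) := `exists_h261_geoCK`, scale transfers :=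
`hST_geoCK`, master rate `δ⋆ = min((1−9∕5000)ρ_G, δ_P)`, `δ_E = (2∕5)δ⋆`, `Θ_E = 3·5^{d+1}(M₂Σ‖b_j‖)²·K_P(A_Gθ)L⁴c₁(δ⋆, ½)`.
[cite: Balaban1985BackgroundPropagators, (3.105) p.414, p.411 l.12–14, p.412 l.31–36, (3.49) p.399, Cor. 3.6 p.408 l.3–14, Thm 3.3 (3.42) p.397, p.409 l.1–5, (3.91) p.410; Balaban1984PropagatorsII, (2.79)–(2.85) pp.237–238, (2.36) p.229, Lemma 2.1 (2.61) p.234, (2.51)–(2.55) p.232] -/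
theorem sum_conj_locDefect_at_locCfg [NormOneClass 𝔸] [DecidableEq ι] (hℓ : 1 ≤ ℓ) (hb₀ : 0 < b₀) (hb₁ : b₀ ≤ b₁) (M₂ : ℝ) (hM₂ : 0 ≤ M₂)
    (hrepr : ∀ (v : 𝔸) (j : ι), |b.repr v j| ≤ M₂ * ‖v‖)
    {δP KP MP TP aP : ℝ} {NP : ℕ} (hδP : 0 < δP) (hKP : 0 ≤ KP) (haP : 0 < aP)
    (hP : ∀ (i : KIdx d ℓ hd hL b₀ b₁) (c : ↥(cubes (toKT i).D.toDomains)) (Rr : ℝ) (H : Prop),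
      MP ≤ ((ℓ : ℝ) + 1) * (toKT i).Mh → NP + 1 ≤ (toKT i).R * ((ℓ + 1) * (toKT i).Mh) → TP ≤ RM1 i →
      ∀ (A : AfldY 𝔸 i) (Q : Set (Site (PV d ℓ i.m i.K hd hL) 0)) (C ξ Λ : ℝ),
      0 ≤ C → 0 < ξ → 1 ≤ Λ → ξ ≤ 5 * (SC i c : ℝ) * (kGeo i).eta → LatticeNorms.scaleLen ((ℓ : ℝ) + 1) (kGeo i).eta (c.1.1 + 1) ≤ Λ * ξ →
      (∀ x : Site (PV d ℓ i.m i.K hd hL) 0, NearC i c (35 * SC i c / 8 + 1) (boxEquiv i.hN x).1 → x ∈ Q) →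
      (∀ κ, ∀ x ∈ Q, ‖A κ x‖ ≤ C * ξ⁻¹) →
      (∀ μ ν, ∀ x ∈ Q, ‖(((kGeo i).eta : ℂ)⁻¹) • covD (shiftsV1 (PV d ℓ i.m i.K hd hL)) (fun _ _ => (1 : 𝔸ˣ)) μ (A ν) x‖ ≤ C * (ξ ^ 2)⁻¹) →
      (∀ (t : ℝ) (κ : Fin (d + 1)) (x : Site (PV d ℓ i.m i.K hd hL) 0), ‖NormedSpace.exp ((I * (t : ℂ)) • A κ x)‖ ≤ 1) →
      sRead C Λ ≤ aP →
      HasMajorant (g := toB6 (geoCK i c) Rr H) (blkBK i c)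
        (conj b ((DPDsCubeY i c (parSymY i) (locCfgY i c (kGeo i).eta A)).restrictScalars ℝ))
        (fun a y => KP * ((geoCK i c).len a ^ 2)⁻¹ * Real.exp (-(δP * (geoCK i c).dist a y)))) :
    ∃ δE ΘE M₀ T₀ : ℝ, ∃ N₀ : ℕ, 0 < δE ∧ 0 ≤ ΘE ∧ ∃ a₁ : ℝ, 0 < a₁ ∧
    ∀ (i : KIdx d ℓ hd hL b₀ b₁),
      M₀ ≤ ((ℓ : ℝ) + 1) * (toKT i).Mh → N₀ + 1 ≤ (toKT i).R * ((ℓ + 1) * (toKT i).Mh) → T₀ ≤ RM1 i →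
    ∀ (u : ↥(cubes (toKT i).D.toDomains) → GaugeY 𝔸 i) (A : ↥(cubes (toKT i).D.toDomains) → AfldY 𝔸 i)
      (Q : ↥(cubes (toKT i).D.toDomains) → Set (Site (PV d ℓ i.m i.K hd hL) 0)) (C ξ Λ : ↥(cubes (toKT i).D.toDomains) → ℝ),
      (∀ c, 0 ≤ C c) → (∀ c, 0 < ξ c) → (∀ c, 1 ≤ Λ c) → (∀ c, ξ c ≤ 5 * (SC i c : ℝ) * (kGeo i).eta) →
      (∀ c, LatticeNorms.scaleLen ((ℓ : ℝ) + 1) (kGeo i).eta (c.1.1 + 1) ≤ Λ c * ξ c) →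
      (∀ c, ∀ x : Site (PV d ℓ i.m i.K hd hL) 0, NearC i c (35 * SC i c / 8 + 1) (boxEquiv i.hN x).1 → x ∈ Q c) →
      (∀ c κ, ∀ x ∈ Q c, ‖A c κ x‖ ≤ C c * (ξ c)⁻¹) →
      (∀ c μ ν, ∀ x ∈ Q c, ‖(((kGeo i).eta : ℂ)⁻¹) • covD (shiftsV1 (PV d ℓ i.m i.K hd hL)) (fun _ _ => (1 : 𝔸ˣ)) μ (A c ν) x‖ ≤ C c * (ξ c ^ 2)⁻¹) →
      (∀ c (t : ℝ) (κ : Fin (d + 1)) (x : Site (PV d ℓ i.m i.K hd hL) 0), ‖NormedSpace.exp ((I * (t : ℂ)) • A c κ x)‖ ≤ 1) →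
      (∀ c, sRead (C c) (Λ c) ≤ a₁) →
      (∀ c x, ‖((u c x : 𝔸ˣ) : 𝔸)‖ ≤ 1 ∧ ‖(((u c x)⁻¹ : 𝔸ˣ) : 𝔸)‖ ≤ 1) →
    ∀ [Fintype (geo9K i).Site] (ιB : BlkY i → IBondY i) (_ : ∀ s, β i.hN i.D i.hk (ιB s) = s) (Rr' : ℝ) (Hp : Prop),
      HasMajorant (g := toB6 (geo9K i) Rr' Hp) (fun p : FBondY i × ι => ιB (blkV1 i.hN i.D p.1))
        (∑ c : ↥(cubes (toKT i).D.toDomains),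
          conj b ((locDefectBY i c (parSymY i) (parBY i) (u c) (chiY i c) (hTY i c) (locCfgY i c (kGeo i).eta (A c))).restrictScalars ℝ))
        (fun a a' => ΘE * Real.exp (-(δE * (toKT i).Mh)) * Real.exp (-(δE * (geo9K i).dist a a'))) ∧
      HasMajorant (g := toB6 (geo9K i) Rr' Hp) (fun p : FBondY i × ι => ιB (blkV1 i.hN i.D p.1))
        (∑ c : ↥(cubes (toKT i).D.toDomains),
          conj b ((locDefectTBY i c (parSymY i) (parBY i) (u c) (chiY i c) (hTY i c) (locCfgY i c (kGeo i).eta (A c))).restrictScalars ℝ))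
        (fun a a' => ΘE * Real.exp (-(δE * (toKT i).Mh)) * Real.exp (-(δE * (geo9K i).dist a a'))) := by
  have hSb : 0 ≤ (M₂ * ∑ j, ‖b j‖) ^ 2 := sq_nonneg _
  have hL1 : (1 : ℝ) ≤ (ℓ : ℝ) + 1 := by linarith [(Nat.cast_nonneg ℓ : (0 : ℝ) ≤ ℓ)]
  -- G-F7 v1.1: the transferred flat entry of `G_□(Ṽ_□)` at the rate `(1 − 9∕5000)ρ₇`
  obtain ⟨ρ₇, θ₇, M₇, T₇, N₇, hρ₇, hθ₇, a₇, ha₇, AG, hAG, h7⟩ := cor36_G_cube_at_locCfg' b hℓ hb₀ hb₁ M₂ hM₂ hrepr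
  -- the master rate
  set δs : ℝ := min ((1 - 9 / 5000) * ρ₇) δP with hδsdef
  have hδs : 0 < δs := lt_min (by positivity) hδP
  have hδs₇ : δs ≤ (1 - 9 / 5000) * ρ₇ := min_le_left _ _
  have hδsP : δs ≤ δP := min_le_right _ _
  -- (2.61) at `(δ⋆, ½)`
  obtain ⟨dB, h261⟩ := exists_h261_geoCK d ℓ hδs
  have hc1 : 0 ≤ B6.c1 dB δs (1 - 1 / 2) := c1_nonneg _ _ _
  set Λ4 : ℝ := ((ℓ : ℝ) + 1) ^ 4 with hΛ4def
  have hΛ4 : 0 ≤ Λ4 := by positivity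
  have hBG : 0 ≤ AG * θ₇ := mul_nonneg hAG hθ₇
  -- the constants
  refine ⟨2 / 5 * δs, 3 * 5 ^ (d + 1) * ((M₂ * ∑ j, ‖b j‖) ^ 2 * (KP * (AG * θ₇) * Λ4 * B6.c1 dB δs (1 - 1 / 2))),
    max M₇ MP, max T₇ (max TP (4 * Real.log ((ℓ : ℝ) + 1) / (9 / 5000 * δs))), max N₇ (max NP (N1 d ℓ (9 / 5000 * δs))),
    by positivity, ?_, min a₇ aP, lt_min ha₇ haP, ?_⟩
  · exact mul_nonneg (by positivity) (mul_nonneg hSb (mul_nonneg (mul_nonneg (mul_nonneg hKP hBG) hΛ4) hc1))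
  intro i hM hN hT u A Q C ξ Λ hC hξ hΛ hξS hΛξ hQ hA hdA hexp hs hu _ ιB hι Rr' Hp
  -- thresholds
  have hM₇ : M₇ ≤ ((ℓ : ℝ) + 1) * (toKT i).Mh := (le_max_left _ _).trans hM
  have hMP : MP ≤ ((ℓ : ℝ) + 1) * (toKT i).Mh := (le_max_right _ _).trans hM
  have hT₇ : T₇ ≤ RM1 i := (le_max_left _ _).trans hT
  have hTP : TP ≤ RM1 i := ((le_max_left _ _).trans (le_max_right _ _)).trans hT
  have hTs : 4 * Real.log ((ℓ : ℝ) + 1) / (9 / 5000 * δs) ≤ RM1 i := ((le_max_right _ _).trans (le_max_right _ _)).trans hT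
  have hNnat : max N₇ (max NP (N1 d ℓ (9 / 5000 * δs))) + 1 ≤ (toKT i).R * ((ℓ + 1) * (toKT i).Mh) := hN
  have hN₇ : N₇ + 1 ≤ (toKT i).R * ((ℓ + 1) * (toKT i).Mh) := le_trans (by simp only [add_le_add_iff_right]; exact le_max_left _ _) hNnat
  have hNP : NP + 1 ≤ (toKT i).R * ((ℓ + 1) * (toKT i).Mh) :=
    le_trans (by simp only [add_le_add_iff_right]; exact (le_max_left _ _).trans (le_max_right _ _)) hNnat
  have hNs : N1 d ℓ (9 / 5000 * δs) + 1 ≤ (toKT i).R * ((ℓ + 1) * (toKT i).Mh) :=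
    le_trans (by simp only [add_le_add_iff_right]; exact (le_max_right _ _).trans (le_max_right _ _)) hNnat
  have hs₇ : ∀ c, sRead (C c) (Λ c) ≤ a₇ := fun c => (hs c).trans (min_le_left _ _)
  have hsP : ∀ c, sRead (C c) (Λ c) ≤ aP := fun c => (hs c).trans (min_le_right _ _)
  -- per cube: the engine data at the master rate
  have hhalf : (1 : ℝ) - 1 / 2 = 1 / 2 := by norm_num
  have h261' : ∀ c : ↥(cubes (toKT i).D.toDomains), Ineq261 dB (toB6 (geoCK i c) Rr' Hp) δs (1 - 1 / 2) := fun c => by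
    rw [hhalf]; exact h261 i c Rr' Hp hNs (1 / 2) (by norm_num) (by norm_num)
  have hST2 : ∀ c : ↥(cubes (toKT i).D.toDomains), ScaleTransfer (geoCK i c) δs (1 / 10) Λ4 (fun a => (geoCK i c).len a ^ 2) := fun c =>
    ((hST_geoCK i c hδs hTs) (1 / 10) (by norm_num)).2.1
  have hST2i : ∀ c : ↥(cubes (toKT i).D.toDomains), ScaleTransfer (geoCK i c) δs (1 / 10) Λ4 (fun a => ((geoCK i c).len a ^ 2)⁻¹) := fun c =>
    ((hST_geoCK i c hδs hTs) (1 / 10) (by norm_num)).2.2.2.1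
  have hG' : ∀ c : ↥(cubes (toKT i).D.toDomains), HasMajorant (g := toB6 (geoCK i c) Rr' Hp) (blkBK i c)
      (GVK b i c (parSymY i) (parBY i) (locCfgY i c (kGeo i).eta (A c)))
      (fun y b' => (AG * θ₇) * (geoCK i c).len y ^ 2 * Real.exp (-(1 * δs * (geoCK i c).dist y b'))) := fun c => by
    obtain ⟨hdnn, -, -, -⟩ := geoCK_dist_axioms i c Rr' Hp
    have h := (h7 i c Rr' Hp hM₇ hN₇ hT₇ (A c) (Q c) (C c) (ξ c) (Λ c) (hC c) (hξ c) (hΛ c) (hξS c) (hΛξ c) (hQ c) (hA c) (hdA c) (hexp c) (hs₇ c)).2.2.2.2.1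
    refine hasMajorant_mono (g := toB6 (geoCK i c) Rr' Hp) _ h fun a a' => ?_
    rw [one_mul, show AG * θ₇ * (geoCK i c).len a ^ 2 = (AG * θ₇) * (geoCK i c).len a ^ 2 from rfl]
    exact kernel_rate_mono hdnn hδs₇ (mul_nonneg hBG (sq_nonneg _)) a a'
  have hP' : ∀ c : ↥(cubes (toKT i).D.toDomains), HasMajorant (g := toB6 (geoCK i c) Rr' Hp) (blkBK i c)
      (conj b ((DPDsCubeY i c (parSymY i) (locCfgY i c (kGeo i).eta (A c))).restrictScalars ℝ))
      (fun a y => KP * ((geoCK i c).len a ^ 2)⁻¹ * Real.exp (-(1 * δs * (geoCK i c).dist a y))) := fun c => by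
    obtain ⟨hdnn, -, -, -⟩ := geoCK_dist_axioms i c Rr' Hp
    have h := hP i c Rr' Hp hMP hNP hTP (A c) (Q c) (C c) (ξ c) (Λ c) (hC c) (hξ c) (hΛ c) (hξS c) (hΛξ c) (hQ c) (hA c) (hdA c) (hexp c) (hsP c)
    refine hasMajorant_mono (g := toB6 (geoCK i c) Rr' Hp) _ h fun a a' => ?_
    rw [one_mul]
    exact kernel_rate_mono hdnn hδsP (mul_nonneg hKP (inv_nonneg.2 (sq_nonneg _))) a a'
  -- D3, both sums
  have hE := hasMajorant_sum_conj_locDefectBY i (parSymY i) (parBY i) b hM₂ hrepr u hu (fun c => locCfgY i c (kGeo i).eta (A c)) ιB hι Rr' Hp Rr' Hp dB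
    (δ₀ := δs) (aP := 1) (bG := 1) (αst := 1 / 10) (asep := 2 / 5) (ρ := 1 / 2) (KP := KP) (BG := AG * θ₇) (Λ := Λ4)
    hδs.le hKP hBG hΛ4 (by norm_num) (by norm_num) (by norm_num) h261' hST2 hP' hG'
  have hET := hasMajorant_sum_conj_locDefectTBY i (parSymY i) (parBY i) b hM₂ hrepr u hu (fun c => locCfgY i c (kGeo i).eta (A c)) ιB hι Rr' Hp Rr' Hp dB
    (δ₀ := δs) (aP := 1) (bG := 1) (αst := 1 / 10) (asep := 2 / 5) (ρ := 1 / 2) (KP := KP) (BG := AG * θ₇) (Λ := Λ4)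
    hδs.le hKP hBG hΛ4 (by norm_num) (by norm_num) (by norm_num) h261' hST2i hG' hP'
  -- the common kernel shape `Θ_E·e^{−δ_E M_h}·e^{−δ_E d}`, `δ_E = (2∕5)δ⋆ ≤ ½δ⋆`
  have hMh : (0 : ℝ) ≤ ((toKT i).Mh : ℝ) := by positivity
  have hpt : ∀ (K : ℝ) (a a' : (geo9K i).Site), 0 ≤ K →
      3 * 5 ^ (d + 1) * ((M₂ * ∑ j, ‖b j‖) ^ 2 * ((K * Real.exp (-(2 / 5 * δs * (toKT i).Mh))) * Real.exp (-(1 / 2 * δs * (geo9K i).dist a a')))) ≤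
      3 * 5 ^ (d + 1) * ((M₂ * ∑ j, ‖b j‖) ^ 2 * K) * Real.exp (-(2 / 5 * δs * (toKT i).Mh)) * Real.exp (-(2 / 5 * δs * (geo9K i).dist a a')) := by
    intro K a a' hK
    have hd := geo9K_dist_nonneg i a a'
    have hexp : Real.exp (-(1 / 2 * δs * (geo9K i).dist a a')) ≤ Real.exp (-(2 / 5 * δs * (geo9K i).dist a a')) :=
      Real.exp_le_exp.2 (by nlinarith [hδs.le])
    calc 3 * 5 ^ (d + 1) * ((M₂ * ∑ j, ‖b j‖) ^ 2 * ((K * Real.exp (-(2 / 5 * δs * (toKT i).Mh))) * Real.exp (-(1 / 2 * δs * (geo9K i).dist a a'))))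
        = (3 * 5 ^ (d + 1) * ((M₂ * ∑ j, ‖b j‖) ^ 2 * K) * Real.exp (-(2 / 5 * δs * (toKT i).Mh))) * Real.exp (-(1 / 2 * δs * (geo9K i).dist a a')) := by ring
      _ ≤ (3 * 5 ^ (d + 1) * ((M₂ * ∑ j, ‖b j‖) ^ 2 * K) * Real.exp (-(2 / 5 * δs * (toKT i).Mh))) * Real.exp (-(2 / 5 * δs * (geo9K i).dist a a')) :=
          mul_le_mul_of_nonneg_left hexp (mul_nonneg (mul_nonneg (by positivity) (mul_nonneg hSb hK)) (Real.exp_nonneg _))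
  refine ⟨hasMajorant_mono (g := toB6 (geo9K i) Rr' Hp) _ hE fun a a' => ?_, hasMajorant_mono (g := toB6 (geo9K i) Rr' Hp) _ hET fun a a' => ?_⟩
  · exact hpt _ a a' (mul_nonneg (mul_nonneg (mul_nonneg hKP hBG) hΛ4) hc1)
  · have h := hpt _ a a' (mul_nonneg (mul_nonneg (mul_nonneg hBG hKP) hΛ4) hc1)
    calc _ ≤ _ := h
      _ = _ := by ring


set_option maxHeartbeats 3200000 in
/-- ★★★ **THE COVER SUMS OF THE TWO DEFECT LETTERS AT THE LOCALISED FIELDS, CLOSED** (M5.1b-G item 2 with NO displayed operator input): `sum_conj_locDefect_at_locCfg`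
with its `hP` supplied by layer D2a — p38 g46's `B9Cor36DPDsCubeAtLocCfg.hasMajorant_conj_DPDsCubeY_at_locCfg` (p.399 (3.49) for `P = I − R` at the cube letters of
p.409, at `Ṽ_□`).  Remaining hypotheses: the member thresholds, the (3.35) cube datum per cube (`u_□` bi-contractive, `A_□` of Hermitian type, `Q_□, C_□, ξ_□, Λ_□`,
`sRead C_□ Λ_□ ≤ a₁`), the section `ιB`.  Two-line plug.
[cite: Balaban1985BackgroundPropagators, (3.105) p.414, p.411 l.12–14, p.412 l.31–36, (3.49) p.399, (3.25) p.394, Cor. 3.6 p.408 l.3–14, Thm 3.3 (3.42) p.397, p.409 l.1–5, (3.91) p.410; Balaban1984PropagatorsII, (2.79)–(2.85) pp.237–238, (2.36) p.229, Lemma 2.1 (2.61) p.234, (2.51)–(2.55) p.232] -/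
theorem sum_conj_locDefect_at_locCfg' [NormOneClass 𝔸] [DecidableEq ι] (hℓ : 1 ≤ ℓ) (hb₀ : 0 < b₀) (hb₁ : b₀ ≤ b₁) (M₂ : ℝ) (hM₂ : 0 ≤ M₂)
    (hrepr : ∀ (v : 𝔸) (j : ι), |b.repr v j| ≤ M₂ * ‖v‖) :
    ∃ δE ΘE M₀ T₀ : ℝ, ∃ N₀ : ℕ, 0 < δE ∧ 0 ≤ ΘE ∧ ∃ a₁ : ℝ, 0 < a₁ ∧
    ∀ (i : KIdx d ℓ hd hL b₀ b₁),
      M₀ ≤ ((ℓ : ℝ) + 1) * (toKT i).Mh → N₀ + 1 ≤ (toKT i).R * ((ℓ + 1) * (toKT i).Mh) → T₀ ≤ RM1 i →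
    ∀ (u : ↥(cubes (toKT i).D.toDomains) → GaugeY 𝔸 i) (A : ↥(cubes (toKT i).D.toDomains) → AfldY 𝔸 i)
      (Q : ↥(cubes (toKT i).D.toDomains) → Set (Site (PV d ℓ i.m i.K hd hL) 0)) (C ξ Λ : ↥(cubes (toKT i).D.toDomains) → ℝ),
      (∀ c, 0 ≤ C c) → (∀ c, 0 < ξ c) → (∀ c, 1 ≤ Λ c) → (∀ c, ξ c ≤ 5 * (SC i c : ℝ) * (kGeo i).eta) →
      (∀ c, LatticeNorms.scaleLen ((ℓ : ℝ) + 1) (kGeo i).eta (c.1.1 + 1) ≤ Λ c * ξ c) →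
      (∀ c, ∀ x : Site (PV d ℓ i.m i.K hd hL) 0, NearC i c (35 * SC i c / 8 + 1) (boxEquiv i.hN x).1 → x ∈ Q c) →
      (∀ c κ, ∀ x ∈ Q c, ‖A c κ x‖ ≤ C c * (ξ c)⁻¹) →
      (∀ c μ ν, ∀ x ∈ Q c, ‖(((kGeo i).eta : ℂ)⁻¹) • covD (shiftsV1 (PV d ℓ i.m i.K hd hL)) (fun _ _ => (1 : 𝔸ˣ)) μ (A c ν) x‖ ≤ C c * (ξ c ^ 2)⁻¹) →
      (∀ c (t : ℝ) (κ : Fin (d + 1)) (x : Site (PV d ℓ i.m i.K hd hL) 0), ‖NormedSpace.exp ((I * (t : ℂ)) • A c κ x)‖ ≤ 1) →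
      (∀ c, sRead (C c) (Λ c) ≤ a₁) →
      (∀ c x, ‖((u c x : 𝔸ˣ) : 𝔸)‖ ≤ 1 ∧ ‖(((u c x)⁻¹ : 𝔸ˣ) : 𝔸)‖ ≤ 1) →
    ∀ [Fintype (geo9K i).Site] (ιB : BlkY i → IBondY i) (_ : ∀ s, β i.hN i.D i.hk (ιB s) = s) (Rr' : ℝ) (Hp : Prop),
      HasMajorant (g := toB6 (geo9K i) Rr' Hp) (fun p : FBondY i × ι => ιB (blkV1 i.hN i.D p.1))
        (∑ c : ↥(cubes (toKT i).D.toDomains),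
          conj b ((locDefectBY i c (parSymY i) (parBY i) (u c) (chiY i c) (hTY i c) (locCfgY i c (kGeo i).eta (A c))).restrictScalars ℝ))
        (fun a a' => ΘE * Real.exp (-(δE * (toKT i).Mh)) * Real.exp (-(δE * (geo9K i).dist a a'))) ∧
      HasMajorant (g := toB6 (geo9K i) Rr' Hp) (fun p : FBondY i × ι => ιB (blkV1 i.hN i.D p.1))
        (∑ c : ↥(cubes (toKT i).D.toDomains),
          conj b ((locDefectTBY i c (parSymY i) (parBY i) (u c) (chiY i c) (hTY i c) (locCfgY i c (kGeo i).eta (A c))).restrictScalars ℝ))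
        (fun a a' => ΘE * Real.exp (-(δE * (toKT i).Mh)) * Real.exp (-(δE * (geo9K i).dist a a'))) := by
  obtain ⟨δP, KP, MP, TP, NP, hδP, hKP, aP, haP, hP⟩ := hasMajorant_conj_DPDsCubeY_at_locCfg b hℓ M₂ hM₂ hrepr
  exact sum_conj_locDefect_at_locCfg b hℓ hb₀ hb₁ M₂ hM₂ hrepr (MP := MP) (TP := TP) (NP := NP) hδP hKP haP
    (fun i c Rr H hM hN hT A Q C ξ Λ hC hξ hΛ hξS hΛξ hQ hA hdA _ hs => hP i c Rr H hM hN hT A Q C ξ Λ hC hξ hΛ hξS hΛξ hQ hA hdA hs)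


/-! ## The `E♯` sum in the currency `ℓ(a)·ℓ(a′)⁻¹` of `hV'`, closed (one member-side scale transfer of `ℓ`, size condition `log L ≤ ½δ_E(2L²−1)·L·M_h`) -/

/-- ★ **SCALE TRANSFER FOR THE WEIGHT `Lʲη` ON THE MEMBER's GEOMETRY** («we may replace the factor (Lʲη)^α by (Lʲη)^β(L^{j′}η)^γ»): under the size condition
`log L ≦ αδ(2L²−1)M` (`αδ > 0`), `e^{−αδd(y,y′)}(L^{j′}η) ≦ L·(Lʲη)` for all `y, y′` (p33's `transferL_geo9K` at `q = 1`; the `q = 2, −4` twins are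
`B9GeoInputsMultiRateKLevelV1.scaleTransfer_len_sq_geo9K ∕ _len_inv4_geo9K`). [cite: Balaban1985BackgroundPropagators, p.398 remark after (3.47); Balaban1984PropagatorsII, Lemma 2.1 (2.60) p.234] -/
theorem scaleTransfer_len_geo9K (i : KIdx d ℓ hd hL b₀ b₁) {δ α : ℝ} (hε : 0 < α * δ)
    (hM : Real.log ((ℓ : ℝ) + 1) ≤ α * δ * (2 * ((ℓ : ℝ) + 1) ^ 2 - 1) * (geo9K i).M) :
    ScaleTransfer (geo9K i) δ α ((ℓ : ℝ) + 1) (fun a => (geo9K i).len a) := by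
  have hL : (geo9K i).L = (ℓ : ℝ) + 1 := by
    show (((ℓ + 1 : ℕ) : ℝ)) = (ℓ : ℝ) + 1
    push_cast; ring
  have hq : |(1 : ℝ)| * Real.log (geo9K i).L ≤ α * δ * (2 * ((ℓ : ℝ) + 1) ^ 2 - 1) * (geo9K i).M := by
    rw [abs_one, one_mul, hL]; exact hM
  have hT := transferL_geo9K i hε (1 : ℝ) hq
  intro y y'
  have h := hT y y'
  rw [Real.rpow_one, Real.rpow_one, abs_one, Real.rpow_one, hL] at h
  have hE : 0 < Real.exp (α * δ * (geo9K i).dist y y') := Real.exp_pos _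
  rw [Real.exp_neg, inv_mul_le_iff₀ hE]
  calc (geo9K i).len y' ≤ ((ℓ : ℝ) + 1) * Real.exp (α * δ * (geo9K i).dist y y') * (geo9K i).len y := h
    _ = Real.exp (α * δ * (geo9K i).dist y y') * (((ℓ : ℝ) + 1) * (geo9K i).len y) := by ring

set_option maxHeartbeats 3200000 in
/-- ★★★ **THE 4th FAMILY OF `hV'` IN ITS CURRENCY, CLOSED**: `Σ_□ conj b(E♯_□(u_□, χ_□, h_□; Ṽ_□)) ≺ Θ_V·e^{−δ_V·M_h}·ℓ(a)·ℓ(a′)⁻¹·e^{−δ_V·d(a,a′)}` over the member's bond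
carrier, uniformly in the member above thresholds and in the family of (3.35) cube data — `sum_conj_locDefect_at_locCfg'` (second conjunct) and D3's
`flat_le_src_weight` with the member-side scale transfer `scaleTransfer_len_geo9K` at `(δ_E, α = ½)`, whose size condition `log L ≦ ½δ_E(2L²−1)·(L·M_h)` is one
more member threshold (`(geo9K i).M = L·M_h`); `δ_V = δ_E∕2`, `Θ_V = Θ_E·L`.
[cite: Balaban1985BackgroundPropagators, (3.105) p.414, p.398 remark after (3.47), p.411 l.12–14, p.412 l.31–36, (3.49) p.399, Cor. 3.6 p.408; Balaban1984PropagatorsII, (2.79)–(2.85) pp.237–238, Lemma 2.1 (2.60)–(2.61) p.234, (2.46) p.231] -/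
theorem sum_conj_locDefectTBY_src_at_locCfg' [NormOneClass 𝔸] [DecidableEq ι] (hℓ : 1 ≤ ℓ) (hb₀ : 0 < b₀) (hb₁ : b₀ ≤ b₁) (M₂ : ℝ) (hM₂ : 0 ≤ M₂)
    (hrepr : ∀ (v : 𝔸) (j : ι), |b.repr v j| ≤ M₂ * ‖v‖) :
    ∃ δE ΘE M₀ T₀ : ℝ, ∃ N₀ : ℕ, 0 < δE ∧ 0 ≤ ΘE ∧ ∃ a₁ : ℝ, 0 < a₁ ∧
    ∀ (i : KIdx d ℓ hd hL b₀ b₁),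
      M₀ ≤ ((ℓ : ℝ) + 1) * (toKT i).Mh → N₀ + 1 ≤ (toKT i).R * ((ℓ + 1) * (toKT i).Mh) → T₀ ≤ RM1 i →
    ∀ (u : ↥(cubes (toKT i).D.toDomains) → GaugeY 𝔸 i) (A : ↥(cubes (toKT i).D.toDomains) → AfldY 𝔸 i)
      (Q : ↥(cubes (toKT i).D.toDomains) → Set (Site (PV d ℓ i.m i.K hd hL) 0)) (C ξ Λ : ↥(cubes (toKT i).D.toDomains) → ℝ),
      (∀ c, 0 ≤ C c) → (∀ c, 0 < ξ c) → (∀ c, 1 ≤ Λ c) → (∀ c, ξ c ≤ 5 * (SC i c : ℝ) * (kGeo i).eta) →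
      (∀ c, LatticeNorms.scaleLen ((ℓ : ℝ) + 1) (kGeo i).eta (c.1.1 + 1) ≤ Λ c * ξ c) →
      (∀ c, ∀ x : Site (PV d ℓ i.m i.K hd hL) 0, NearC i c (35 * SC i c / 8 + 1) (boxEquiv i.hN x).1 → x ∈ Q c) →
      (∀ c κ, ∀ x ∈ Q c, ‖A c κ x‖ ≤ C c * (ξ c)⁻¹) →
      (∀ c μ ν, ∀ x ∈ Q c, ‖(((kGeo i).eta : ℂ)⁻¹) • covD (shiftsV1 (PV d ℓ i.m i.K hd hL)) (fun _ _ => (1 : 𝔸ˣ)) μ (A c ν) x‖ ≤ C c * (ξ c ^ 2)⁻¹) →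
      (∀ c (t : ℝ) (κ : Fin (d + 1)) (x : Site (PV d ℓ i.m i.K hd hL) 0), ‖NormedSpace.exp ((I * (t : ℂ)) • A c κ x)‖ ≤ 1) →
      (∀ c, sRead (C c) (Λ c) ≤ a₁) →
      (∀ c x, ‖((u c x : 𝔸ˣ) : 𝔸)‖ ≤ 1 ∧ ‖(((u c x)⁻¹ : 𝔸ˣ) : 𝔸)‖ ≤ 1) →
    ∀ [Fintype (geo9K i).Site] (ιB : BlkY i → IBondY i) (_ : ∀ s, β i.hN i.D i.hk (ιB s) = s) (Rr' : ℝ) (Hp : Prop),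
      HasMajorant (g := toB6 (geo9K i) Rr' Hp) (fun p : FBondY i × ι => ιB (blkV1 i.hN i.D p.1))
        (∑ c : ↥(cubes (toKT i).D.toDomains),
          conj b ((locDefectTBY i c (parSymY i) (parBY i) (u c) (chiY i c) (hTY i c) (locCfgY i c (kGeo i).eta (A c))).restrictScalars ℝ))
        (fun a a' => ΘE * Real.exp (-(δE * (toKT i).Mh)) * (geo9K i).len a * ((geo9K i).len a')⁻¹ * Real.exp (-(δE * (geo9K i).dist a a'))) := by
  have hL1 : (1 : ℝ) ≤ (ℓ : ℝ) + 1 := by linarith [(Nat.cast_nonneg ℓ : (0 : ℝ) ≤ ℓ)]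
  obtain ⟨δE, ΘE, M₀, T₀, N₀, hδE, hΘE, a₁, ha₁, h⟩ := sum_conj_locDefect_at_locCfg' b hℓ hb₀ hb₁ M₂ hM₂ hrepr
  have hq : 0 < 2 * ((ℓ : ℝ) + 1) ^ 2 - 1 := by nlinarith
  have hden : 0 < 1 / 2 * δE * (2 * ((ℓ : ℝ) + 1) ^ 2 - 1) := by positivity
  refine ⟨δE / 2, ΘE * ((ℓ : ℝ) + 1), max M₀ (Real.log ((ℓ : ℝ) + 1) / (1 / 2 * δE * (2 * ((ℓ : ℝ) + 1) ^ 2 - 1))), T₀, N₀,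
    by positivity, by positivity, a₁, ha₁, ?_⟩
  intro i hM hN hT u A Q C ξ Λ hC hξ hΛ hξS hΛξ hQ hA hdA hexp hs hu _ ιB hι Rr' Hp
  have hM₀ : M₀ ≤ ((ℓ : ℝ) + 1) * (toKT i).Mh := (le_max_left _ _).trans hM
  have h2 := (h i hM₀ hN hT u A Q C ξ Λ hC hξ hΛ hξS hΛξ hQ hA hdA hexp hs hu ιB hι Rr' Hp).2
  -- the member-side scale transfer of `ℓ` at `(δ_E, ½)` from the extra threshold
  have hMV : Real.log ((ℓ : ℝ) + 1) ≤ 1 / 2 * δE * (2 * ((ℓ : ℝ) + 1) ^ 2 - 1) * (geo9K i).M := by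
    have hMdef : (geo9K i).M = (((ℓ + 1 : ℕ) : ℝ)) * ((toKT i).Mh : ℝ) := rfl
    have h1 : Real.log ((ℓ : ℝ) + 1) / (1 / 2 * δE * (2 * ((ℓ : ℝ) + 1) ^ 2 - 1)) ≤ ((ℓ : ℝ) + 1) * (toKT i).Mh := (le_max_right _ _).trans hM
    rw [div_le_iff₀ hden] at h1
    calc Real.log ((ℓ : ℝ) + 1) ≤ ((ℓ : ℝ) + 1) * (toKT i).Mh * (1 / 2 * δE * (2 * ((ℓ : ℝ) + 1) ^ 2 - 1)) := h1
      _ = 1 / 2 * δE * (2 * ((ℓ : ℝ) + 1) ^ 2 - 1) * (geo9K i).M := by rw [hMdef]; push_cast; ring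
  have hSTm := scaleTransfer_len_geo9K i (δ := δE) (α := 1 / 2) (by positivity) hMV
  refine hasMajorant_mono (g := toB6 (geo9K i) Rr' Hp) _ h2 fun a a' => ?_
  have hκ : 0 ≤ ΘE * Real.exp (-(δE * (toKT i).Mh)) := mul_nonneg hΘE (Real.exp_nonneg _)
  have h3 := flat_le_src_weight i (δ := δE) (αm := 1 / 2) (Λm := (ℓ : ℝ) + 1) hκ hSTm a a'
  have hla : 0 < (geo9K i).len a := B6KLevelCensusIndexV1.len_pos i a
  have hla' : 0 < (geo9K i).len a' := B6KLevelCensusIndexV1.len_pos i a'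
  have hMh : (0 : ℝ) ≤ ((toKT i).Mh : ℝ) := by positivity
  have hX : 0 ≤ ΘE * ((ℓ : ℝ) + 1) * (geo9K i).len a * ((geo9K i).len a')⁻¹ * Real.exp (-(δE / 2 * (geo9K i).dist a a')) :=
    mul_nonneg (mul_nonneg (mul_nonneg (mul_nonneg hΘE (by positivity)) hla.le) (inv_nonneg.2 hla'.le)) (Real.exp_nonneg _)
  have hexpM : Real.exp (-(δE * (toKT i).Mh)) ≤ Real.exp (-(δE / 2 * (toKT i).Mh)) := Real.exp_le_exp.2 (by nlinarith [hδE.le])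
  have e12 : (1 - 1 / 2) * δE = δE / 2 := by ring
  rw [e12] at h3
  calc ΘE * Real.exp (-(δE * (toKT i).Mh)) * Real.exp (-(δE * (geo9K i).dist a a'))
      ≤ ΘE * Real.exp (-(δE * (toKT i).Mh)) * ((ℓ : ℝ) + 1) * (geo9K i).len a * ((geo9K i).len a')⁻¹ *
          Real.exp (-(δE / 2 * (geo9K i).dist a a')) := h3
    _ = (ΘE * ((ℓ : ℝ) + 1) * (geo9K i).len a * ((geo9K i).len a')⁻¹ * Real.exp (-(δE / 2 * (geo9K i).dist a a'))) *
          Real.exp (-(δE * (toKT i).Mh)) := by ring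
    _ ≤ (ΘE * ((ℓ : ℝ) + 1) * (geo9K i).len a * ((geo9K i).len a')⁻¹ * Real.exp (-(δE / 2 * (geo9K i).dist a a'))) *
          Real.exp (-(δE / 2 * (toKT i).Mh)) := mul_le_mul_of_nonneg_left hexpM hX
    _ = ΘE * ((ℓ : ℝ) + 1) * Real.exp (-(δE / 2 * (toKT i).Mh)) * (geo9K i).len a * ((geo9K i).len a')⁻¹ *
          Real.exp (-(δE / 2 * (geo9K i).dist a a')) := by ring

end Literature.MathematicalPhysics.QuantumFieldTheory.Balaban1983to89.B9Cor36GCubeLocDefectAtLocCfg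

end
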